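import Literature.NumberTheory.EllipticCurves.PAdicOneVariableInverseTransform
import HarnessLib

/-!
# Integration against the distribution of a power series via MAHLER COEFFICIENTS
# (de Shalit 1987, I.3.5 (11): the moments `∫ κ^k dμ_β = D^k log g_β(0)`)

De Shalit 1987, I.3.3 (8) (p. 17): "`ã_β(S) = ∫_{ℤ_p} (1 + S)^α dμ_β(α)`"; I.3.5 (11) (p. 18): "The
moments of `μ_β` are given by the formula `∫_G κ(σ)^k dμ_β(σ) = D^k log g_β(0)` (`k ≥ 0`)" — all
integrals against a measure given by its power series are read off the Mahler expansion of the
integrand: if `f = Σ_j a_j (x choose j)` (Mahler, `a_j = Δ^j[f](0) → 0`) and `P_μ = Σ c_j S^j`, then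
`∫ f dμ = Σ_j a_j c_j`.

For the inverse one-variable Amice transform `invAmice₁ p P hC` (`PAdicOneVariableInverseTransform.lean`)
and a continuous `ℤ_p`-valued `f` on `ℤ_p` read in `𝕜`, this file proves

* **`hasSum_integral_invAmice₁`**: `Σ_j c_j · Δ^j[f](0) = ∫ f dD_P` (`HasSum`), from the inversion
  theorem `∫ (x choose j) dD_P = c_j`, Mahler's theorem (Mathlib `PadicInt.hasSum_mahler`) and the
  passage of uniform limits under the integral;
* `integral_invAmice₁_eq_tsum` (the `tsum` form) and `integral_invAmice₁_eq_sum_of_fwdDiff_eq_zero`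
  (a finite sum when the Mahler coefficients vanish beyond `N`, e.g. polynomials `x^k`: the moments).

Everything is a theorem; no named facts, no instances, no `sorry`.

## References

* [deShalit1987] E. de Shalit, *Iwasawa theory of elliptic curves with complex multiplication* (1987),
  I.3.3 (8) (p. 17), I.3.5 (11) (p. 18).
* [Washington1997] L. C. Washington, *Introduction to Cyclotomic Fields*, §12.2.
-/

noncomputable section

open Filter Topology
open scoped fwdDiff

namespace Literature.NumberTheory.EllipticCurves

variable {p : ℕ} [Fact p.Prime]
variable {𝕜 : Type*} [NormedField 𝕜] [NormedAlgebra ℚ_[p] 𝕜] [IsUltrametricDist 𝕜] [CompleteSpace 𝕜]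
variable {P : PowerSeries 𝕜} {C : ℝ}

/-- **The integral of a finite Mahler sum** `Σ_{j<N} a_j (x choose j)` against `D_P` is `Σ_{j<N} c_j a_j`
(inversion theorem + linearity). [cite: deShalit1987, I.3.3 (8) (p. 17)] -/
theorem integral_invAmice₁_sum_mahlerTerm (hC : ∀ k, ‖PowerSeries.coeff k P‖ ≤ C) (a : ℕ → ℤ_[p])
    (N : ℕ) :
    (invAmice₁ p P hC).integral
        (fun x ↦ padicIntCast 𝕜 ((∑ j ∈ Finset.range N, PadicInt.mahlerTerm (a j) j : C(ℤ_[p], ℤ_[p])) x)) =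
      ∑ j ∈ Finset.range N, PowerSeries.coeff j P * padicIntCast 𝕜 (a j) := by
  have hfun : (fun x ↦ padicIntCast 𝕜 ((∑ j ∈ Finset.range N, PadicInt.mahlerTerm (a j) j : C(ℤ_[p], ℤ_[p])) x)) =
      fun x ↦ ∑ j ∈ Finset.range N, mahlerFun₁ 𝕜 j x * padicIntCast 𝕜 (a j) := by
    funext x
    rw [ContinuousMap.coe_sum, Finset.sum_apply, map_sum]
    refine Finset.sum_congr rfl fun j _ ↦ ?_
    rw [PadicInt.mahlerTerm_apply, smul_eq_mul, map_mul, mahlerFun₁_apply]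
  rw [hfun, (invAmice₁ p P hC).integral_finset_sum _
    (fun j _ ↦ uniformContinuous_mul_const (uniformContinuous_mahlerFun₁ j) _)]
  refine Finset.sum_congr rfl fun j _ ↦ ?_
  rw [(invAmice₁ p P hC).integral_mul_const _ (uniformContinuous_mahlerFun₁ j),
    integral_invAmice₁_mahlerFun₁ hC j]

/-- The terms `c_j · Δ^j[f](0)` of the Mahler integration series are summable (bounded times null).
[cite: deShalit1987, I.3.3 (8) (p. 17)] -/
theorem summable_coeff_mul_fwdDiff (hC : ∀ k, ‖PowerSeries.coeff k P‖ ≤ C) (f : C(ℤ_[p], ℤ_[p])) :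
    Summable fun j : ℕ ↦ PowerSeries.coeff j P * padicIntCast 𝕜 (Δ_[1] ^[j] (⇑f) 0) := by
  refine summable_mul_of_tendsto_zero hC ?_
  have h := ((continuous_padicIntCast (𝕜 := 𝕜)).tendsto 0).comp (PadicInt.fwdDiff_tendsto_zero f)
  rw [map_zero] at h
  exact h

/-- **Integration via Mahler coefficients: `Σ_j c_j · Δ^j[f](0) = ∫ f dD_P`** for every continuous
`ℤ_p`-valued `f` on `ℤ_p` (read in `𝕜`) — de Shalit's reading of all integrals against `μ_β` off its
power series (I.3.3 (8); the moments I.3.5 (11) are the case `f = κ^k`).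
[cite: deShalit1987, I.3.3 (8) (p. 17), I.3.5 (11) (p. 18)] -/
theorem hasSum_integral_invAmice₁ (hC : ∀ k, ‖PowerSeries.coeff k P‖ ≤ C) (f : C(ℤ_[p], ℤ_[p])) :
    HasSum (fun j : ℕ ↦ PowerSeries.coeff j P * padicIntCast 𝕜 (Δ_[1] ^[j] (⇑f) 0))
      ((invAmice₁ p P hC).integral (fun x ↦ padicIntCast 𝕜 (f x))) := by
  set a : ℕ → ℤ_[p] := fun j ↦ Δ_[1] ^[j] (⇑f) 0 with ha
  set F : ℕ → C(ℤ_[p], ℤ_[p]) := fun N ↦ ∑ j ∈ Finset.range N, PadicInt.mahlerTerm (a j) j with hF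
  -- Mahler: `F N → f` uniformly
  have hMahler : Tendsto F atTop (𝓝 f) := (PadicInt.hasSum_mahler f).tendsto_sum_nat
  have hnorm : Tendsto (fun N ↦ ‖F N - f‖) atTop (𝓝 0) := by
    have h := (tendsto_iff_norm_sub_tendsto_zero.mp hMahler)
    exact h
  -- integrals of the partial sums converge to the integral of `f`
  have hint : Tendsto (fun N ↦ (invAmice₁ p P hC).integral (fun x ↦ padicIntCast 𝕜 (F N x))) atTop
      (𝓝 ((invAmice₁ p P hC).integral (fun x ↦ padicIntCast 𝕜 (f x)))) := by
    refine (invAmice₁ p P hC).tendsto_integral_of_forall_norm_sub_le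
      (F := fun N x ↦ padicIntCast 𝕜 (F N x)) (f := fun x ↦ padicIntCast 𝕜 (f x))
      (fun N ↦ CompactSpace.uniformContinuous_of_continuous
        (continuous_padicIntCast.comp (F N).continuous))
      (CompactSpace.uniformContinuous_of_continuous (continuous_padicIntCast.comp f.continuous))
      (e := fun N ↦ ‖F N - f‖) (fun N ↦ norm_nonneg _) (fun N x ↦ ?_) hnorm
    rw [← map_sub, norm_padicIntCast, ← ContinuousMap.sub_apply]
    exact (F N - f).norm_coe_le_norm x
  -- the integrals of the partial sums are the partial sums of the series
  have hpartial : ∀ N, (invAmice₁ p P hC).integral (fun x ↦ padicIntCast 𝕜 (F N x)) =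
      ∑ j ∈ Finset.range N, PowerSeries.coeff j P * padicIntCast 𝕜 (a j) :=
    fun N ↦ integral_invAmice₁_sum_mahlerTerm hC a N
  simp_rw [hpartial] at hint
  -- a summable series whose partial sums converge has that limit as its sum
  have hs : Summable fun j : ℕ ↦ PowerSeries.coeff j P * padicIntCast 𝕜 (a j) :=
    summable_coeff_mul_fwdDiff hC f
  have heq : ∑' j, PowerSeries.coeff j P * padicIntCast 𝕜 (a j) =
      (invAmice₁ p P hC).integral (fun x ↦ padicIntCast 𝕜 (f x)) :=
    tendsto_nhds_unique hs.tendsto_sum_tsum_nat hint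
  rw [← heq]
  exact hs.hasSum

/-- The `tsum` form: `∫ f dD_P = Σ' c_j · Δ^j[f](0)`. [cite: deShalit1987, I.3.3 (8) (p. 17)] -/
theorem integral_invAmice₁_eq_tsum (hC : ∀ k, ‖PowerSeries.coeff k P‖ ≤ C) (f : C(ℤ_[p], ℤ_[p])) :
    (invAmice₁ p P hC).integral (fun x ↦ padicIntCast 𝕜 (f x)) =
      ∑' j : ℕ, PowerSeries.coeff j P * padicIntCast 𝕜 (Δ_[1] ^[j] (⇑f) 0) :=
  (hasSum_integral_invAmice₁ hC f).tsum_eq.symm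

/-- **Finite form**: if the Mahler coefficients of `f` vanish from `N` on (e.g. `f` a polynomial of
degree `< N`, such as `κ^k` — the MOMENTS I.3.5 (11)), then `∫ f dD_P = Σ_{j<N} c_j · Δ^j[f](0)`.
[cite: deShalit1987, I.3.5 (11) (p. 18)] -/
theorem integral_invAmice₁_eq_sum_of_fwdDiff_eq_zero (hC : ∀ k, ‖PowerSeries.coeff k P‖ ≤ C)
    (f : C(ℤ_[p], ℤ_[p])) {N : ℕ} (hN : ∀ j, N ≤ j → Δ_[1] ^[j] (⇑f) 0 = 0) :
    (invAmice₁ p P hC).integral (fun x ↦ padicIntCast 𝕜 (f x)) =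
      ∑ j ∈ Finset.range N, PowerSeries.coeff j P * padicIntCast 𝕜 (Δ_[1] ^[j] (⇑f) 0) := by
  refine ((hasSum_integral_invAmice₁ hC f).tsum_eq.symm).trans (tsum_eq_sum fun j hj ↦ ?_)
  rw [Finset.mem_range, not_lt] at hj
  rw [hN j hj, map_zero, mul_zero]

/-- **The moments of `D_P`**: for the power function `x ↦ x^k` (a polynomial of degree `k`, whose
Mahler coefficients vanish beyond `k`), `∫ x^k dD_P = Σ_{j ≤ k} c_j · Δ^j[x^k](0)` — de Shalit's (11)
`∫ κ^k dμ_β = D^k log g_β(0)` in coefficient form. [cite: deShalit1987, I.3.5 (11) (p. 18)] -/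
theorem integral_invAmice₁_pow (hC : ∀ k, ‖PowerSeries.coeff k P‖ ≤ C) (k : ℕ) :
    (invAmice₁ p P hC).integral (fun x ↦ padicIntCast 𝕜 (x ^ k)) =
      ∑ j ∈ Finset.range (k + 1),
        PowerSeries.coeff j P * padicIntCast 𝕜 (Δ_[1] ^[j] (fun x : ℤ_[p] ↦ x ^ k) 0) := by
  set f : C(ℤ_[p], ℤ_[p]) := ⟨fun x ↦ x ^ k, continuous_id.pow k⟩ with hf
  have hcoe : (⇑f : ℤ_[p] → ℤ_[p]) = fun x ↦ x ^ k := rfl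
  have h := integral_invAmice₁_eq_sum_of_fwdDiff_eq_zero hC f (N := k + 1) (fun j hj ↦ by
    rw [hcoe]
    have hP : (fun x : ℤ_[p] ↦ x ^ k) = fun x ↦ (Polynomial.X ^ k : Polynomial ℤ_[p]).eval x := by
      funext x; rw [Polynomial.eval_pow, Polynomial.eval_X]
    rw [hP]
    exact congrFun (Polynomial.fwdDiff_iter_eq_zero_of_degree_lt
      (P := (Polynomial.X ^ k : Polynomial ℤ_[p])) (by rw [Polynomial.natDegree_X_pow]; omega)) 0)
  rw [hcoe] at h
  exact h

end Literature.NumberTheory.EllipticCurves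

end
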